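import Literature.MathematicalPhysics.QuantumFieldTheory.Balaban1983to89.B9Eq358TowerKernelSizes
import Literature.MathematicalPhysics.QuantumFieldTheory.Balaban1983to89.B9Eq342CovariantResolventAdjointRow
import Literature.MathematicalPhysics.QuantumFieldTheory.Balaban1983to89.B9Eq342GreenPrimeSupBound

/-!
# `Balaban1983to89.B9Eq343GreenPrimeDstarTwoBackgroundIdentity` — T. Bałaban, *Propagators for lattice gauge theories in a background field*, Commun. Math. Phys. **99** (1985)
# 389–434 [Balaban1985BackgroundPropagators] (3.60)–(3.65) pp. 402–403 (*«G′(U) − G′(1) = …»*, the perturbation `V′(A)` and its averaging part (3.59)), (3.23)–(3.25) p. 394,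
# Thm 3.4 p. 400 for (3.43) p. 398: **THE DUHAMEL IDENTITY FOR THE TWO-BACKGROUND DIFFERENCE OF `G′_k(U)D*_U` AND THE POINTWISE LETTER OF THE BLOCK PENALTY BETWEEN TWO
# BACKGROUNDS** — the first file of the discharge of gen 103's located letter `Hω` (the η-scale ½-Hölder ladder of `ω = R_kG′_kD*_Uf`; ROUTE (J′), `H3 ⇐ Hω` landed as
# `B9Eq3152ThirdWordPiTwoBackgroundGradLetterOfOmegaHolder`).  With `z¹ = G′_k(1)D*_1f`:
# `G′_k(U)D*_Uf − G′_k(1)D*_1f = G′_k(U)[(D*_U − D*_1)f] − G′_k(U)[(Δ′_{a′,k}(U) − Δ′_{a′,k}(1))z¹]` and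
# `(Δ′_{a′,k}(U) − Δ′_{a′,k}(1))z¹ = D*_Uq¹ + s¹ + (penalty(U) − penalty(1))z¹` with the VALUE data `q¹, s¹` of `B9Eq342CovariantResolventAdjointRow.covLaplace_sub_flat_eq` — so that
# ONLY ONE-BACKGROUND rows of `G′_k(U)` (all CLOSED on the model: the Hölder row of `G′_kD*_U`, the value ∕ gradient rows on decaying data) on `O(α)`-small data are needed; no
# two-background bootstrap.  The penalty letter: `‖((a′Q̃′_k(U)†Q̃′_k(U) − a′Q̃′_k(1)†Q̃′_k(1))v)(x)‖ ≤ M_φ′|a′|C_q(2 + 4C_qα)·4α·M_φ·sup_{block of x}‖v‖` — r06's `norm_avgOp_le` on the exact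
# identity `B9Eq324PenaltyKernelForm.readA_penalty_sub_penalty_eq_avgOp` with the (3.59) kernel sizes `B9Eq358TowerKernelSizes.norm_{kF,sF}_le_of_class`.  NE9 crux-team LEAF PROVER 01, gen 103.

statement-level skeleton of published theorems with citation tags; proofs where landed; nothing here is a claim about the Yang–Mills mass gap

CITATION HEADER (lean-in-tree rule).  Audit cell `pub-balaban`, sub-cell `t4`, BINDER row NE9; filed by NE9 crux-team LEAF PROVER 01 (`b2b-balaban-t4-ne9-formalise-leaf-01`,
gen 103; bears_on: R4/N22).  Source READ first-hand (`paper:balaban1985-cmp99-background-propagators`, pp. 393–394, 398, 400, 402–403).  REUSED BY NAME: the files named above,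
`B9Eq357QprimeTowerKernelForm.{norm_kQ_le, card_block_blkK_mul_inv_eq_one}`, `B9Eq324PenaltyKernelForm.{readA_apply, norm_sQ_one_le}`, `B5Eq172HodgePositivity.adTransportW_{one,inv_one}`,
`B11Eq103H1Complex.{greenK_apply, apply_greenK}`.  [folklore] bookkeeping; nothing printed is a hypothesis.

WHAT IS PROVED (sorry-free; proof lane — 0 `def`).
* §1 **`norm_penalty_sub_flat_apply_le`** — the two-background block-penalty letter, pointwise on a block.
* §2 **`GpOfUk_covDiv_sub_flat_eq`** (the Duhamel identity), **`laplacePrimeAk_sub_flat_apply_eq`** (the split of the perturbation into `D*_Uq¹ + s¹` and the penalty part).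
HONEST SCOPE.  Identities and one pointwise letter on the MODEL; NOT summit progress (cell pub-balaban: NE9 NOT PRINTED ∕ NOT PROVED; «NE9 ⇐ the named binders»; row WALLED ON A
MODEL (O-NE9-1; #5 UNRULED); spine PROVED 0∕9; rung (B)+1 finite T⁴ — NOT infinite volume, NOT mass gap, NOT BetaPertH, NOT Clay).  HONEST DEPENDENCY: continuum YM on T⁴ ⇐
BetaPertH ∧ nine spine estimates (0/9 proved); BetaPertH ⇐ (D1) ∧ (D4) ∧ CAP+tail; G-an2-4 gates asym, D1 and NE2/3/4.  NEW file; nothing modified.  Net new unproved facts: 0.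
-/


noncomputable section

open scoped InnerProductSpace BigOperators

namespace Literature.MathematicalPhysics.QuantumFieldTheory.Balaban1983to89.B9Eq343GreenPrimeDstarTwoBackgroundIdentity

open B4Sect5Torus (TSite)
open B9SectCLatticeCarrier (Bond bpos btgt shift unshift)
open B9Eq311L2Pairing (WL2)
open B7Prop1Explicit (U1)
open B9Eq310HessianOperator (adTransportW)
open B9Eq315QTower (towerP UlevOf)
open B9Eq324DeltaPrimeATower (laplacePrimeAk GpOfUk)
open B11Eq103H1Complex (SiteL2K BondL2K covDivL2K covLaplaceSiteK greenK greenK_apply apply_greenK)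
open B9Eq33CovDerivVector (adTransport)
open B9Eq324PenaltyKernelForm (readA readA_apply sQ norm_sQ_one_le readA_penalty_sub_penalty_eq_avgOp)
open B9Eq357QprimeTowerKernelForm (blkK kQ norm_kQ_le card_block_blkK_mul_inv_eq_one)
open B9Eq358TowerKernelSizes (kQ_flatLevels_eq norm_kF_le_of_class norm_sF_le_of_class exp_window_sub_one_le)
open B9Eq360VprimeLetters (norm_avgOp_le)
open B9Eq342CovariantResolventAdjointRow (covLaplace_sub_flat_eq)

section Main

variable {d : ℕ} (L : ℕ) [NeZero L]
  {𝔸 : Type*} [NormedRing 𝔸] [NormedAlgebra ℂ 𝔸] [CompleteSpace 𝔸] [NormOneClass 𝔸] [FiniteDimensional ℂ 𝔸]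
  {W : Type*} [NormedAddCommGroup W] [InnerProductSpace ℂ W] [FiniteDimensional ℂ W] (φ : W ≃ₗ[ℂ] 𝔸)
  {a' Mφ Mφ' : ℝ} (hMφ : 0 ≤ Mφ) (hMφ' : 0 ≤ Mφ') (hφ : ∀ w, ‖φ w‖ ≤ Mφ * ‖w‖) (hφ' : ∀ X, ‖φ.symm X‖ ≤ Mφ' * ‖X‖)
  {r : ℝ} (hr0 : 0 ≤ r) (hr1 : r < 1)

/-! ## §1 The two-background letter of the block penalty `a′Q̃′_k(U)†Q̃′_k(U) − a′Q̃′_k(1)†Q̃′_k(1)`, pointwise on a block -/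

include hMφ hMφ' hφ hφ' hr0 hr1 in
/-- **THE PENALTY OF `Δ′_{a′,k}` BETWEEN TWO BACKGROUNDS, POINTWISE**: on print's small-field class with levels `ε_j ≤ αr^j` in `U1` and `α ≤ 1∕16`, on the diagonal
`c₀(L^{n+1})^d = c₁`, for every site function `v` and site `x`: `‖((Δ′_{a′,k}(U) − Δ^η_U)v)(x) − ((Δ′_{a′,k}(1) − Δ^η_1)v)(x)‖ ≤ M_φ′·|a′|·C_q(2 + 4C_qα)·4α·M_φ·B`
whenever `‖v‖ ≤ B` on the block of `x` — r06's `norm_avgOp_le` on the exact identity `B9Eq324PenaltyKernelForm.readA_penalty_sub_penalty_eq_avgOp` with the (3.59) kernel sizes of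
`B9Eq358TowerKernelSizes`. [cite: Balaban1985BackgroundPropagators, (3.59)–(3.60) p.402, (3.24) p.394, (3.19) p.393] -/
theorem norm_penalty_sub_flat_apply_le (n : ℕ) (η : ℝ) (c₀ c₁ : ℝ) [Fact (0 < c₀)] [Fact (0 < c₁)] (hw : c₀ * ((L : ℝ) ^ (n + 1)) ^ d = c₁)
    (m : Fin d → ℕ) [∀ i, NeZero (m i)] (U : Bond d (towerP L m (n + 1)) → 𝔸ˣ) (α : ℝ) (hα : 0 ≤ α) (hα16 : α ≤ 1 / 16)
    (εU : ℕ → ℝ) (hεU : ∀ j, 0 ≤ εU j) (hεU1 : ∀ j, εU j ≤ 1) (hεg : ∀ j < n + 1, εU j ≤ α * r ^ j)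
    (hLε : ∀ (j : ℕ) (bd : Bond d (towerP L m (j + 1))), ‖(UlevOf L m (n + 1) U j bd : 𝔸) - 1‖ ≤ εU j)
    (hLb : ∀ (j : ℕ) (bd : Bond d (towerP L m (j + 1))), UlevOf L m (n + 1) U j bd ∈ U1 𝔸)
    (v : SiteL2K ℂ d (towerP L m (n + 1)) c₀ W) (x : TSite d (towerP L m (n + 1))) (B : ℝ)
    (hB : ∀ x', blkK L m n x' = blkK L m n x → ‖WL2.equiv ℂ (fun _ : TSite d (towerP L m (n + 1)) => c₀) W v x'‖ ≤ B) :
    ‖WL2.equiv ℂ (fun _ : TSite d (towerP L m (n + 1)) => c₀) W ((laplacePrimeAk L m n φ η U a' (c₀ := c₀) (c₁ := c₁) -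
          covLaplaceSiteK (c₀ := c₀) ((η : ℂ))⁻¹ (adTransportW φ U) (adTransportW φ fun b => (U b)⁻¹)) v) x -
      WL2.equiv ℂ (fun _ : TSite d (towerP L m (n + 1)) => c₀) W ((laplacePrimeAk L m n φ η (fun _ : Bond d (towerP L m (n + 1)) => (1 : 𝔸ˣ)) a' (c₀ := c₀) (c₁ := c₁) -
          covLaplaceSiteK (c₀ := c₀) ((η : ℂ))⁻¹ (adTransportW φ (fun _ : Bond d (towerP L m (n + 1)) => (1 : 𝔸ˣ)))
            (adTransportW φ fun b => ((fun _ : Bond d (towerP L m (n + 1)) => (1 : 𝔸ˣ)) b)⁻¹)) v) x‖ ≤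
      Mφ' * (|a'| * ((((d * (L - 1) : ℕ) : ℝ) * (3 / (1 - r)) * Real.exp (((d * (L - 1) : ℕ) : ℝ) * (3 / (1 - r)) * (1 / 16)) +
          Mφ * Mφ' * (((d * (L - 1) : ℕ) : ℝ) * (2 * Mφ * Mφ' / (1 - r)) * Real.exp (((d * (L - 1) : ℕ) : ℝ) * (2 * Mφ * Mφ' / (1 - r)) * (1 / 16)))) / 4) *
        (2 + ((((d * (L - 1) : ℕ) : ℝ) * (3 / (1 - r)) * Real.exp (((d * (L - 1) : ℕ) : ℝ) * (3 / (1 - r)) * (1 / 16)) +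
          Mφ * Mφ' * (((d * (L - 1) : ℕ) : ℝ) * (2 * Mφ * Mφ' / (1 - r)) * Real.exp (((d * (L - 1) : ℕ) : ℝ) * (2 * Mφ * Mφ' / (1 - r)) * (1 / 16)))) / 4) * (4 * α)) *
        (4 * α) * (Mφ * B)) := by
  classical
  -- the (3.59) constants
  set ck : ℝ := ((d * (L - 1) : ℕ) : ℝ) * (3 / (1 - r)) with hck
  set cs : ℝ := ((d * (L - 1) : ℕ) : ℝ) * (2 * Mφ * Mφ' / (1 - r)) with hcs
  have h1r : 0 < 1 - r := by linarith
  have hck0 : 0 ≤ ck := by positivity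
  have hcs0 : 0 ≤ cs := by positivity
  set Cq : ℝ := (ck * Real.exp (ck * (1 / 16)) + Mφ * Mφ' * (cs * Real.exp (cs * (1 / 16)))) / 4 with hCq
  have hCq0 : 0 ≤ Cq := by positivity
  have hB0 : 0 ≤ B := (norm_nonneg _).trans (hB x rfl)
  -- the kernel letters
  set kQ1 := kQ L m n (fun j => adTransport (𝕜 := ℂ) (UlevOf L m (n + 1) (fun _ : Bond d (towerP L m (n + 1)) => (1 : 𝔸ˣ)) j)) with hkQ1
  set kQU := kQ L m n (fun j => adTransport (𝕜 := ℂ) (UlevOf L m (n + 1) U j)) with hkQU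
  set sQ1 := sQ L m n φ (fun _ : Bond d (towerP L m (n + 1)) => (1 : 𝔸ˣ)) (c₀ := c₀) (c₁ := c₁) with hsQ1
  set sQU := sQ L m n φ U (c₀ := c₀) (c₁ := c₁) with hsQU
  set wgt : TSite d m → ℝ := fun _ => (((L : ℝ) ^ (n + 1)) ^ d)⁻¹ with hwgt
  have hkQ1flat : kQ1 = kQ L m n (fun _ _ => (LinearMap.id : 𝔸 →ₗ[ℂ] 𝔸)) := kQ_flatLevels_eq L m n
  have hkQ : ∀ y x', blkK L m n x' = y → ‖kQ1 y x'‖ ≤ wgt y := fun y x' _ => by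
    rw [hkQ1flat]; exact norm_kQ_le L m n _ (fun _ _ v => le_rfl) y x'
  have hcard : ∀ y, ((B9Eq360Vprime.block (blkK L m n) y).card : ℝ) * wgt y ≤ 1 := fun y => (card_block_blkK_mul_inv_eq_one L m n y).le
  have hc₀ : (0 : ℝ) < c₀ := Fact.out
  have hdiag : c₁ / c₀ * (((L : ℝ) ^ (n + 1)) ^ d)⁻¹ = 1 := by
    rw [← hw, mul_comm c₀, mul_div_assoc, div_self hc₀.ne', mul_one, mul_inv_cancel₀ (pow_ne_zero _ (pow_ne_zero _ (by exact_mod_cast NeZero.ne L)))]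
  have hsQ : ∀ x', ‖sQ1 x'‖ ≤ 1 := fun x' => (norm_sQ_one_le L m n φ (c₀ := c₀) (c₁ := c₁) x').trans hdiag.le
  have hexpk : Real.exp (ck * α) - 1 ≤ (ck * Real.exp (ck * (1 / 16))) * α := exp_window_sub_one_le hck0 hα hα16
  have hexps : Real.exp (cs * α) - 1 ≤ (cs * Real.exp (cs * (1 / 16))) * α := exp_window_sub_one_le hcs0 hα hα16
  have hCq4 : Cq * (4 * α) = (ck * Real.exp (ck * (1 / 16))) * α + Mφ * Mφ' * ((cs * Real.exp (cs * (1 / 16))) * α) := by rw [hCq]; ring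
  have hkF : ∀ y x', blkK L m n x' = y → ‖(kQU - kQ1) y x'‖ ≤ Cq * (4 * α) * wgt y := by
    intro y x' _
    rw [hkQ1flat]
    refine (norm_kF_le_of_class L m n U εU hεU hεU1 hLε hLb hr0 hr1 hα hεg y x').trans ?_
    have e1 : ((d * (L - 1) : ℕ) : ℝ) * (3 * α / (1 - r)) = ck * α := by rw [hck]; ring
    rw [e1, hCq4]
    refine mul_le_mul_of_nonneg_right (hexpk.trans ?_) (by positivity)
    have : 0 ≤ Mφ * Mφ' * ((cs * Real.exp (cs * (1 / 16))) * α) := by positivity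
    linarith
  have hsF : ∀ x', ‖(sQU - sQ1) x'‖ ≤ Cq * (4 * α) := by
    intro x'
    rw [Pi.sub_apply]
    refine (norm_sF_le_of_class L m n φ U εU hεU hLε hLb hr0 hr1 hα hεg hMφ hMφ' hφ hφ' x').trans ?_
    have e1 : ((d * (L - 1) : ℕ) : ℝ) * (2 * Mφ * Mφ' * α / (1 - r)) = cs * α := by rw [hcs]; ring
    rw [e1, hCq4]
    calc Mφ * Mφ' * (c₁ / c₀ * ((Real.exp (cs * α) - 1) * (((L : ℝ) ^ (n + 1)) ^ d)⁻¹))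
        = Mφ * Mφ' * (Real.exp (cs * α) - 1) * (c₁ / c₀ * (((L : ℝ) ^ (n + 1)) ^ d)⁻¹) := by ring
      _ = Mφ * Mφ' * (Real.exp (cs * α) - 1) := by rw [hdiag, mul_one]
      _ ≤ Mφ * Mφ' * ((cs * Real.exp (cs * (1 / 16))) * α) := mul_le_mul_of_nonneg_left hexps (by positivity)
      _ ≤ (ck * Real.exp (ck * (1 / 16))) * α + Mφ * Mφ' * ((cs * Real.exp (cs * (1 / 16))) * α) := by
          have : 0 ≤ (ck * Real.exp (ck * (1 / 16))) * α := by positivity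
          linarith
  -- the `𝔸`-reading of `v`
  set F : TSite d (towerP L m (n + 1)) → 𝔸 := fun z => φ (WL2.equiv ℂ (fun _ : TSite d (towerP L m (n + 1)) => c₀) W v z) with hF
  have hv : ((WL2.equiv ℂ (fun _ : TSite d (towerP L m (n + 1)) => c₀) W).symm fun z => φ.symm (F z)) = v := by
    apply (WL2.equiv ℂ (fun _ : TSite d (towerP L m (n + 1)) => c₀) W).injective
    funext z
    rw [Equiv.apply_symm_apply, hF, LinearEquiv.symm_apply_apply]
  have hread : ∀ T : SiteL2K ℂ d (towerP L m (n + 1)) c₀ W →ₗ[ℂ] SiteL2K ℂ d (towerP L m (n + 1)) c₀ W,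
      WL2.equiv ℂ (fun _ : TSite d (towerP L m (n + 1)) => c₀) W (T v) x = φ.symm (readA φ T F x) := fun T => by
    rw [readA_apply, hv, LinearEquiv.symm_apply_apply]
  have hFB : ∀ x', blkK L m n x' = blkK L m n x → ‖F x'‖ ≤ Mφ * B := fun x' hx' => (hφ _).trans (mul_le_mul_of_nonneg_left (hB x' hx') hMφ)
  have e : ∀ T₁ T₂ : SiteL2K ℂ d (towerP L m (n + 1)) c₀ W →ₗ[ℂ] SiteL2K ℂ d (towerP L m (n + 1)) c₀ W,
      readA φ T₁ F x - readA φ T₂ F x = (readA φ T₁ - readA φ T₂) F x := fun T₁ T₂ => by simp only [LinearMap.sub_apply, Pi.sub_apply]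
  rw [hread, hread, ← map_sub, e, readA_penalty_sub_penalty_eq_avgOp L m n φ η U (fun _ : Bond d (towerP L m (n + 1)) => (1 : 𝔸ˣ)) a' (c₀ := c₀) (c₁ := c₁)]
  refine (hφ' _).trans (mul_le_mul_of_nonneg_left ?_ hMφ')
  have h := norm_avgOp_le (blkK L m n) kQ1 (kQU - kQ1) sQ1 (sQU - sQ1) (fun _ : TSite d m => a') (fun _ => (1 : ℝ)) wgt Cq (4 * α) |a'|
    (fun _ => one_pos) (fun _ => by positivity) hcard hCq0 (by positivity) (abs_nonneg _) hkQ hkF hsQ hsF (fun _ => by simp) F x (Mφ * B) hFB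
  simpa only [one_pow, inv_one, mul_one] using h

/-! ## §2 The two-background (Duhamel) identity for `G′_k(U)D*_U f − G′_k(1)D*_1 f` -/

omit [NormOneClass 𝔸] [FiniteDimensional ℂ 𝔸] in
/-- **`G′_k(U)D*_Uf − G′_k(1)D*_1f = G′_k(U)[(D*_U − D*_1)f] − G′_k(U)[(Δ′_{a′,k}(U) − Δ′_{a′,k}(1))(G′_k(1)D*_1f)]`** — the resolvent identity
`G′(U) − G′(1) = −G′(U)(Δ′(U) − Δ′(1))G′(1)` ([B9] (3.65): *«G′(U) − G′(1) = …»*) applied to `D*_1f`, plus `G′(U)(D*_U − D*_1)f`. [cite: Balaban1985BackgroundPropagators, (3.65) p.403, (3.24)–(3.25) p.394] -/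
theorem GpOfUk_covDiv_sub_flat_eq (n : ℕ) (η : ℝ) (c₀ c₁ : ℝ) [Fact (0 < c₀)] [Fact (0 < c₁)] (m : Fin d → ℕ) [∀ i, NeZero (m i)]
    (U : Bond d (towerP L m (n + 1)) → 𝔸ˣ)
    (hpos' : ∀ x : SiteL2K ℂ d (towerP L m (n + 1)) c₀ W, x ≠ 0 → 0 < RCLike.re ⟪x, laplacePrimeAk L m n φ η U a' (c₁ := c₁) x⟫_ℂ)
    (hpos'₁ : ∀ x : SiteL2K ℂ d (towerP L m (n + 1)) c₀ W, x ≠ 0 →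
      0 < RCLike.re ⟪x, laplacePrimeAk L m n φ η (fun _ : Bond d (towerP L m (n + 1)) => (1 : 𝔸ˣ)) a' (c₁ := c₁) x⟫_ℂ)
    (f : BondL2K ℂ d (towerP L m (n + 1)) c₀ W) :
    GpOfUk L m n φ η U a' (c₁ := c₁) hpos' (covDivL2K ℂ c₀ ((η : ℂ))⁻¹ (adTransportW φ fun b => (U b)⁻¹) f) -
        GpOfUk L m n φ η (fun _ : Bond d (towerP L m (n + 1)) => (1 : 𝔸ˣ)) a' (c₁ := c₁) hpos'₁
          (covDivL2K ℂ c₀ ((η : ℂ))⁻¹ (adTransportW φ fun b => ((fun _ : Bond d (towerP L m (n + 1)) => (1 : 𝔸ˣ)) b)⁻¹) f) =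
      GpOfUk L m n φ η U a' (c₁ := c₁) hpos' (covDivL2K ℂ c₀ ((η : ℂ))⁻¹ (adTransportW φ fun b => (U b)⁻¹) f -
          covDivL2K ℂ c₀ ((η : ℂ))⁻¹ (adTransportW φ fun b => ((fun _ : Bond d (towerP L m (n + 1)) => (1 : 𝔸ˣ)) b)⁻¹) f) -
        GpOfUk L m n φ η U a' (c₁ := c₁) hpos' ((laplacePrimeAk L m n φ η U a' (c₀ := c₀) (c₁ := c₁) -
            laplacePrimeAk L m n φ η (fun _ : Bond d (towerP L m (n + 1)) => (1 : 𝔸ˣ)) a' (c₀ := c₀) (c₁ := c₁))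
          (GpOfUk L m n φ η (fun _ : Bond d (towerP L m (n + 1)) => (1 : 𝔸ˣ)) a' (c₁ := c₁) hpos'₁
            (covDivL2K ℂ c₀ ((η : ℂ))⁻¹ (adTransportW φ fun b => ((fun _ : Bond d (towerP L m (n + 1)) => (1 : 𝔸ˣ)) b)⁻¹) f))) := by
  unfold GpOfUk
  rw [map_sub, LinearMap.sub_apply, map_sub, greenK_apply, apply_greenK]
  abel

omit [NormOneClass 𝔸] [FiniteDimensional ℂ 𝔸] in
/-- **The perturbation splits into the divergence-form Laplacian part and the penalty part**:
`(Δ′_{a′,k}(U) − Δ′_{a′,k}(1))z = (Δ^η_U − Δ^η_1)z + ((Δ′_{a′,k}(U) − Δ^η_U) − (Δ′_{a′,k}(1) − Δ^η_1))z`, and `(Δ^η_U − Δ^η_1)z = D*_Uq + s` with the VALUE data `q`, `s` of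
`B9Eq342CovariantResolventAdjointRow.covLaplace_sub_flat_eq` (the flat transporters `Ad(1)` are pointwise the identity). [cite: Balaban1985BackgroundPropagators, (3.60) p.402, (3.23)–(3.24) p.394] -/
theorem laplacePrimeAk_sub_flat_apply_eq (n : ℕ) (η : ℝ) (c₀ c₁ : ℝ) [Fact (0 < c₀)] [Fact (0 < c₁)] (m : Fin d → ℕ) [∀ i, NeZero (m i)]
    (U : Bond d (towerP L m (n + 1)) → 𝔸ˣ) (z : SiteL2K ℂ d (towerP L m (n + 1)) c₀ W) :
    (laplacePrimeAk L m n φ η U a' (c₀ := c₀) (c₁ := c₁) - laplacePrimeAk L m n φ η (fun _ : Bond d (towerP L m (n + 1)) => (1 : 𝔸ˣ)) a' (c₀ := c₀) (c₁ := c₁)) z =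
      (covDivL2K ℂ c₀ ((η : ℂ))⁻¹ (adTransportW φ fun b => (U b)⁻¹)
          ((WL2.equiv ℂ (fun _ : Bond d (towerP L m (n + 1)) => c₀) W).symm fun b : Bond d (towerP L m (n + 1)) =>
            ((η : ℂ))⁻¹ • ((adTransportW φ U b (WL2.equiv ℂ _ W z (btgt b)) - WL2.equiv ℂ _ W z (btgt b)) -
              (adTransportW φ (fun b => (U b)⁻¹) b (WL2.equiv ℂ _ W z (bpos b)) - WL2.equiv ℂ _ W z (bpos b)))) +
        (WL2.equiv ℂ (fun _ : TSite d (towerP L m (n + 1)) => c₀) W).symm fun x : TSite d (towerP L m (n + 1)) =>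
          (((η : ℂ))⁻¹ ^ 2) • ∑ μ, ((adTransportW φ (fun b => (U b)⁻¹) (unshift μ x, μ)
              (adTransportW φ (fun b => (U b)⁻¹) (unshift μ x, μ) (WL2.equiv ℂ _ W z (unshift μ x)) - WL2.equiv ℂ _ W z (unshift μ x)) -
              (adTransportW φ (fun b => (U b)⁻¹) (unshift μ x, μ) (WL2.equiv ℂ _ W z (unshift μ x)) - WL2.equiv ℂ _ W z (unshift μ x))) +
            (adTransportW φ (fun b => (U b)⁻¹) (unshift μ x, μ) (WL2.equiv ℂ _ W z x) - adTransportW φ (fun b => (U b)⁻¹) (x, μ) (WL2.equiv ℂ _ W z x)))) +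
      ((laplacePrimeAk L m n φ η U a' (c₀ := c₀) (c₁ := c₁) - covLaplaceSiteK (c₀ := c₀) ((η : ℂ))⁻¹ (adTransportW φ U) (adTransportW φ fun b => (U b)⁻¹)) z -
        (laplacePrimeAk L m n φ η (fun _ : Bond d (towerP L m (n + 1)) => (1 : 𝔸ˣ)) a' (c₀ := c₀) (c₁ := c₁) -
          covLaplaceSiteK (c₀ := c₀) ((η : ℂ))⁻¹ (adTransportW φ (fun _ : Bond d (towerP L m (n + 1)) => (1 : 𝔸ˣ)))
            (adTransportW φ fun b => ((fun _ : Bond d (towerP L m (n + 1)) => (1 : 𝔸ˣ)) b)⁻¹)) z) := by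
  have hflat : covLaplaceSiteK (c₀ := c₀) ((η : ℂ))⁻¹ (adTransportW φ (fun _ : Bond d (towerP L m (n + 1)) => (1 : 𝔸ˣ)))
      (adTransportW φ fun b => ((fun _ : Bond d (towerP L m (n + 1)) => (1 : 𝔸ˣ)) b)⁻¹) =
      covLaplaceSiteK (c₀ := c₀) ((η : ℂ))⁻¹ (fun _ : Bond d (towerP L m (n + 1)) => (LinearMap.id : W →ₗ[ℂ] W)) (fun _ => LinearMap.id) := by
    have h1 : adTransportW φ (fun _ : Bond d (towerP L m (n + 1)) => (1 : 𝔸ˣ)) = fun _ => LinearMap.id := funext fun b => B5Eq172HodgePositivity.adTransportW_one φ b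
    have h2 : (adTransportW φ fun b => ((fun _ : Bond d (towerP L m (n + 1)) => (1 : 𝔸ˣ)) b)⁻¹) = fun _ => LinearMap.id :=
      funext fun b => B5Eq172HodgePositivity.adTransportW_inv_one φ b
    rw [h1, h2]
  have hsplit := covLaplace_sub_flat_eq (c₀ := c₀) η⁻¹ (adTransportW φ U) (adTransportW φ fun b => (U b)⁻¹) (B9Eq342GreenPrimeSupBound.adTransportW_inv_adTransportW φ U) z
  simp only [Complex.ofReal_inv, Complex.ofReal_pow] at hsplit
  rw [← hsplit, hflat]
  simp only [LinearMap.sub_apply]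
  abel

end Main

end Literature.MathematicalPhysics.QuantumFieldTheory.Balaban1983to89.B9Eq343GreenPrimeDstarTwoBackgroundIdentity

end
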